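import Mathlib.InformationTheory.KullbackLeibler.Basic
import Literature.MathematicalPhysics.KineticTheory.HardSphereEulerProofs
import Literature.Analysis.FluidPDE.HardSphereDynamicsProofs
import Summits.AtomisticToContinuum.HydrodynamicLimit.Theorems.CollisionIsometryCLTMacroClosureStubLedgerScaling
import HarnessLib

/-!
# Stub `stub_ledger` of the line `IdeatorTwoSketch` (crux `MacroClosure`), part 2: the two-reference
Liouville transport identity (L1)

Support file (`--supports stmt-AtomisticToContinuum-14870`) for the registered stub
`stub_ledger : LedgerIdentity`. This part proves conjunct (L1) of `LedgerIdentity`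
(`ledger_transport`): for an absolutely continuous initial law `P = W₀ · dZ` and two continuous
positive local Gibbs parameter triples,
`H((Φ_t)_* P ‖ Ψ₂) = H(P ‖ Ψ₁) + (N+1) E_P[⟨emp, log prof₁⟩ − ⟨emp ∘ Φ_t, log prof₂⟩] + log Z₂ − log Z₁`.

The abstract core `toReal_klDiv_lawAt_particleLaw` (two positive reference densities `ψ₁, ψ₂`
w.r.t. the Liouville measure) and its two helpers `llr_particleLaw_ae`,
`toReal_klDiv_particleLaw` (specialised to particle laws) are adapted from the PROVED transport identity
`entropyTransportIdentity_holds` of the crux scratch file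
`Cruxes/MacroClosure/IdeatorThreeSketch.lean` (Liouville invariance
`HardSphereFlow.lawAt_withDensity_holds`, `flow_neg_flow`, `ae_mem_good`, and the explicit
log-likelihood ratio of absolutely continuous laws). The specialisation to local Gibbs references
uses part 1 (`localGibbsLaw_eq_particleLaw_tensorPow`, `log_gibbsDensity`,
`integrable_logPair_comp`). As in part 1 the line's vocabulary (`Flow`, `Zpart`,
`logProfilePair`) is written unfolded, so that this file does not depend on the definitions module.
-/

noncomputable section

open MeasureTheory Filter Set Topology InformationTheory
open scoped ENNReal ContDiff

namespace Summit.AtomisticToContinuum.HydrodynamicLimit.Theorems.MacroClosureLine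

open Literature.MathematicalPhysics.KineticTheory Literature.Analysis.FluidPDE
open Literature.Analysis.FunctionSpaces

namespace StubLedger

/-! ## Log-likelihood ratio of two particle laws -/

-- adapted from Cruxes/MacroClosure/IdeatorThreeSketch.lean (`llr_withDensity_ofReal_ae`), specialised
-- to particle laws (densities w.r.t. the Liouville measure of `N + 1` hard spheres on `𝕋³`)
/-- Log-likelihood ratio between two particle laws `W · dZ` and `ψ · dZ` with `W ≥ 0`, `ψ > 0`
real densities w.r.t. the Liouville measure: `llr = log W − log ψ` almost everywhere under
`W · dZ`. [folklore] -/
theorem llr_particleLaw_ae {N : ℕ} {ε : ℝ} (Φ : HardSphereFlow (Torus.geometry (Fin 3)) ε (N + 1))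
    {W ψ : Config (N + 1) (Fin 3) T3 → ℝ} (hW : Measurable W) (hψ : Measurable ψ)
    (hW0 : ∀ z, 0 ≤ W z) (hψpos : ∀ z, 0 < ψ z) [IsProbabilityMeasure (particleLaw Φ W)] :
    llr (particleLaw Φ W) (particleLaw Φ ψ) =ᵐ[particleLaw Φ W]
      fun z => Real.log (W z) - Real.log (ψ z) := by
  haveI hXE : SigmaFinite (volume : Measure (UnitAddTorus (Fin 3) × EuclideanSpace ℝ (Fin 3))) :=
    inferInstance
  haveI hCfg : SigmaFinite (volume : Measure (Config (N + 1) (Fin 3) (UnitAddTorus (Fin 3)))) :=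
    inferInstance
  haveI hL : SigmaFinite (liouville (Torus.geometry (Fin 3)) (N + 1) ε) := by
    rw [liouville_eq]; infer_instance
  set L := liouville (Torus.geometry (Fin 3)) (N + 1) ε with hL_def
  have hPW : particleLaw Φ W = L.withDensity fun z => ENNReal.ofReal (W z) := particleLaw_eq Φ W
  have hPψ : particleLaw Φ ψ = L.withDensity fun z => ENNReal.ofReal (ψ z) := particleLaw_eq Φ ψ
  have hf : Measurable fun z => ENNReal.ofReal (W z) := ENNReal.measurable_ofReal.comp hW
  have hg : Measurable fun z => ENNReal.ofReal (ψ z) := ENNReal.measurable_ofReal.comp hψ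
  have hg0 : ∀ᵐ z ∂L, ENNReal.ofReal (ψ z) ≠ 0 :=
    ae_of_all _ fun z => (ENNReal.ofReal_pos.mpr (hψpos z)).ne'
  have hgtop : ∀ᵐ z ∂L, ENNReal.ofReal (ψ z) ≠ (⊤ : ℝ≥0∞) :=
    ae_of_all _ fun z => ENNReal.ofReal_ne_top
  have hμL : particleLaw Φ W ≪ L := by rw [hPW]; exact withDensity_absolutelyContinuous _ _
  have h1 : (particleLaw Φ W).rnDeriv (particleLaw Φ ψ)
      =ᵐ[L] fun z => (ENNReal.ofReal (ψ z))⁻¹ * (particleLaw Φ W).rnDeriv L z := by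
    rw [hPψ]
    exact Measure.rnDeriv_withDensity_right _ L hg.aemeasurable hg0 hgtop
  have h2 : (particleLaw Φ W).rnDeriv L =ᵐ[L] fun z => ENNReal.ofReal (W z) := by
    rw [hPW]
    exact Measure.rnDeriv_withDensity L hf
  have h3 : ∀ᵐ z ∂(particleLaw Φ W), ENNReal.ofReal (W z) ≠ 0 := by
    rw [hPW]
    exact (ae_withDensity_iff hf).mpr (ae_of_all _ fun z hz => hz)
  filter_upwards [hμL.ae_le h1, hμL.ae_le h2, h3] with z hz1 hz2 hz3
  have hWpos : 0 < W z := by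
    rcases (hW0 z).lt_or_eq with h | h
    · exact h
    · exact absurd (by rw [← h, ENNReal.ofReal_zero]) hz3
  simp only [MeasureTheory.llr, hz1, hz2]
  rw [ENNReal.toReal_mul, ENNReal.toReal_inv, ENNReal.toReal_ofReal (hψpos z).le,
    ENNReal.toReal_ofReal (hW0 z), Real.log_mul (inv_ne_zero (hψpos z).ne') hWpos.ne',
    Real.log_inv]
  ring

-- adapted from Cruxes/MacroClosure/IdeatorThreeSketch.lean (`toReal_klDiv_withDensity_ofReal`)
/-- Relative entropy between two particle laws `W · dZ` and `ψ · dZ` (probability measures) with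
`W ≥ 0`, `ψ > 0`: `H(W dZ ‖ ψ dZ) = ∫ (log W − log ψ) W dZ` (junk-consistent: both sides are `0`
if the integrand is not integrable). [folklore] -/
theorem toReal_klDiv_particleLaw {N : ℕ} {ε : ℝ}
    (Φ : HardSphereFlow (Torus.geometry (Fin 3)) ε (N + 1))
    {W ψ : Config (N + 1) (Fin 3) T3 → ℝ} (hW : Measurable W) (hψ : Measurable ψ)
    (hW0 : ∀ z, 0 ≤ W z) (hψpos : ∀ z, 0 < ψ z) [IsProbabilityMeasure (particleLaw Φ W)]
    [IsProbabilityMeasure (particleLaw Φ ψ)] :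
    (klDiv (particleLaw Φ W) (particleLaw Φ ψ)).toReal =
      ∫ z, (Real.log (W z) - Real.log (ψ z)) ∂(particleLaw Φ W) := by
  have hg : Measurable fun z => ENNReal.ofReal (ψ z) := ENNReal.measurable_ofReal.comp hψ
  have hg0 : ∀ᵐ z ∂(liouville (Torus.geometry (Fin 3)) (N + 1) ε), ENNReal.ofReal (ψ z) ≠ 0 :=
    ae_of_all _ fun z => (ENNReal.ofReal_pos.mpr (hψpos z)).ne'
  have hμL : particleLaw Φ W ≪ liouville (Torus.geometry (Fin 3)) (N + 1) ε :=
    withDensity_absolutelyContinuous _ _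
  have hLν : liouville (Torus.geometry (Fin 3)) (N + 1) ε ≪ particleLaw Φ ψ :=
    withDensity_absolutelyContinuous' hg.aemeasurable hg0
  rw [toReal_klDiv_of_measure_eq (hμL.trans hLν) (by rw [measure_univ, measure_univ])]
  exact integral_congr_ae (llr_particleLaw_ae Φ hW hψ hW0 hψpos)

/-! ## The two-reference transport identity -/

-- adapted from Cruxes/MacroClosure/IdeatorThreeSketch.lean (`entropyTransportIdentity_holds`)
/-- **Two-reference Liouville transport identity.** For `N + 1` hard spheres of diameter `ε` on
`𝕋³`, a hard-sphere flow `Φ`, an initial law `P = W₀ · dZ` and two positive reference densities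
`ψ₁, ψ₂` w.r.t. the Liouville measure `dZ` (all three laws probability measures) with
`H(P ‖ ψ₁ dZ) < ∞` and `log ψ₁`, `log ψ₂ ∘ Φ_t` `P`-integrable:
`H((Φ_t)_* P ‖ ψ₂ dZ) = H(P ‖ ψ₁ dZ) + ∫ (log ψ₁ − log ψ₂ ∘ Φ_t) dP`.
Liouville invariance (`HardSphereFlow.lawAt_withDensity_holds`) gives `(Φ_t)_* P = (W₀ ∘ Φ_{-t}) dZ`,
and `∫ f_t log f_t dZ = ∫ f_0 log f_0 dZ`. [folklore] -/
theorem toReal_klDiv_lawAt_particleLaw {N : ℕ} {ε : ℝ}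
    (Φ : HardSphereFlow (Torus.geometry (Fin 3)) ε (N + 1))
    {W₀ ψ₁ ψ₂ : Config (N + 1) (Fin 3) T3 → ℝ} (hW : Measurable W₀) (hψ₁ : Measurable ψ₁)
    (hψ₂ : Measurable ψ₂) (hW0 : ∀ z, 0 ≤ W₀ z) (hψ₁pos : ∀ z, 0 < ψ₁ z) (hψ₂pos : ∀ z, 0 < ψ₂ z)
    [IsProbabilityMeasure (particleLaw Φ W₀)] [IsProbabilityMeasure (particleLaw Φ ψ₁)]
    [IsProbabilityMeasure (particleLaw Φ ψ₂)]
    (hkl : klDiv (particleLaw Φ W₀) (particleLaw Φ ψ₁) ≠ ⊤)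
    (t : ℝ) (hint₁ : Integrable (fun z => Real.log (ψ₁ z)) (particleLaw Φ W₀))
    (hint₂ : Integrable (fun z => Real.log (ψ₂ (Φ.flow t z))) (particleLaw Φ W₀)) :
    (klDiv (Φ.lawAt (particleLaw Φ W₀) t) (particleLaw Φ ψ₂)).toReal =
      (klDiv (particleLaw Φ W₀) (particleLaw Φ ψ₁)).toReal +
        ∫ z, (Real.log (ψ₁ z) - Real.log (ψ₂ (Φ.flow t z))) ∂(particleLaw Φ W₀) := by
  have hf : Measurable fun z => ENNReal.ofReal (W₀ z) := ENNReal.measurable_ofReal.comp hW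
  have hμL : particleLaw Φ W₀ ≪ liouville (Torus.geometry (Fin 3)) (N + 1) ε :=
    withDensity_absolutelyContinuous _ _
  have hgood : ∀ᵐ z ∂(particleLaw Φ W₀), z ∈ Φ.good := hμL.ae_le Φ.ae_mem_good
  -- the law at time `t` has density `W₀ ∘ Φ_{-t}` (mild Liouville equation)
  have hlaw : Φ.lawAt (particleLaw Φ W₀) t = particleLaw Φ fun z => W₀ (Φ.flow (-t) z) :=
    HardSphereFlow.lawAt_withDensity_holds Φ hf t
  haveI hPt : IsProbabilityMeasure (particleLaw Φ fun z => W₀ (Φ.flow (-t) z)) := by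
    rw [← hlaw, HardSphereFlow.lawAt_eq]
    exact Measure.isProbabilityMeasure_map (Φ.measurable_flow t).aemeasurable
  rw [hlaw, toReal_klDiv_particleLaw (W := fun z => W₀ (Φ.flow (-t) z)) Φ
      (hW.comp (Φ.measurable_flow (-t))) hψ₂ (fun z => hW0 _) hψ₂pos,
    toReal_klDiv_particleLaw Φ hW hψ₁ hW0 hψ₁pos]
  -- back to the push-forward to integrate along the flow
  have hF : Measurable fun x => Real.log (W₀ (Φ.flow (-t) x)) - Real.log (ψ₂ x) :=
    (Real.measurable_log.comp (hW.comp (Φ.measurable_flow (-t)))).sub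
      (Real.measurable_log.comp hψ₂)
  rw [← hlaw, HardSphereFlow.lawAt_eq,
    integral_map (f := fun x => Real.log (W₀ (Φ.flow (-t) x)) - Real.log (ψ₂ x))
      (Φ.measurable_flow t).aemeasurable hF.aestronglyMeasurable]
  -- integrability of the two pieces on the right
  have h1int : Integrable (fun z => Real.log (W₀ z) - Real.log (ψ₁ z)) (particleLaw Φ W₀) :=
    (klDiv_ne_top_iff.mp hkl).2.congr (llr_particleLaw_ae Φ hW hψ₁ hW0 hψ₁pos)
  have h2int : Integrable (fun z => Real.log (ψ₁ z) - Real.log (ψ₂ (Φ.flow t z)))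
      (particleLaw Φ W₀) := hint₁.sub hint₂
  rw [← integral_add h1int h2int]
  refine integral_congr_ae ?_
  filter_upwards [hgood] with z hz
  rw [Φ.flow_neg_flow t hz]
  ring

/-! ## (L1) for local Gibbs references -/

/-- **(L1)** The two-reference Liouville transport identity for local Gibbs references
`Ψᵢ = localGibbsLaw σ aᵢ uᵢ θᵢ N Φ` (continuous positive parameters, `σ < 1/2`) and an
absolutely continuous initial law `P = W₀ · dZ` with `H(P ‖ Ψ₁) < ∞` and integrable kinetic
energy at times `0` and `t`:
`H((Φ_t)_* P ‖ Ψ₂) = H(P ‖ Ψ₁) + (N+1) (E_P ⟨emp, log prof₁⟩ − E_P ⟨emp ∘ Φ_t, log prof₂⟩) + log Z₂ − log Z₁`.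
[folklore] -/
theorem ledger_transport {σ : ℝ} (hσ2 : σ < 2⁻¹) (N : ℕ)
    (Φ : HardSphereFlow (Torus.geometry (Fin 3)) (hsDiameter σ N) (N + 1))
    (a₁ θ₁ a₂ θ₂ : T3 → ℝ) (u₁ u₂ : T3 → V3) (ha₁ : Continuous a₁) (hθ₁ : Continuous θ₁)
    (hu₁ : Continuous u₁) (ha₂ : Continuous a₂) (hθ₂ : Continuous θ₂) (hu₂ : Continuous u₂)
    (ha₁0 : ∀ x, 0 < a₁ x) (hθ₁0 : ∀ x, 0 < θ₁ x) (ha₂0 : ∀ x, 0 < a₂ x)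
    (hθ₂0 : ∀ x, 0 < θ₂ x)
    (W₀ : Config (N + 1) (Fin 3) T3 → ℝ) (hW : Measurable W₀) (hW0 : ∀ z, 0 ≤ W₀ z)
    (hP : IsProbabilityMeasure (particleLaw Φ W₀))
    (hkl : klDiv (particleLaw Φ W₀) (localGibbsLaw σ a₁ u₁ θ₁ N Φ) ≠ ⊤) (t : ℝ)
    (hK0 : Integrable (fun z => ∫ y, ‖y.2‖ ^ 2 ∂(empiricalMeasure z)) (particleLaw Φ W₀))
    (hKt : Integrable (fun z => ∫ y, ‖y.2‖ ^ 2 ∂(empiricalMeasure (Φ.flow t z)))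
      (particleLaw Φ W₀)) :
    (klDiv (Φ.lawAt (particleLaw Φ W₀) t) (localGibbsLaw σ a₂ u₂ θ₂ N Φ)).toReal =
      (klDiv (particleLaw Φ W₀) (localGibbsLaw σ a₁ u₁ θ₁ N Φ)).toReal +
        ((N : ℝ) + 1) *
          ((∫ z, (∫ y, Real.log (localGibbsProfile a₁ u₁ θ₁ y) ∂(empiricalMeasure z))
              ∂(particleLaw Φ W₀)) -
            ∫ z, (∫ y, Real.log (localGibbsProfile a₂ u₂ θ₂ y) ∂(empiricalMeasure (Φ.flow t z)))
              ∂(particleLaw Φ W₀)) +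
        Real.log
          (canonicalPartition (Torus.geometry (Fin 3)) (hsDiameter σ N) (N + 1) (localGibbsProfile a₂ u₂ θ₂)) -
        Real.log
          (canonicalPartition (Torus.geometry (Fin 3)) (hsDiameter σ N) (N + 1) (localGibbsProfile a₁ u₁ θ₁)) := by
  have hσ2' : σ ≤ 1 / 2 := by rw [one_div]; exact hσ2.le
  -- the two references as positive densities w.r.t. the Liouville measure
  haveI hΨ₁ : IsProbabilityMeasure (particleLaw Φ fun z =>
      (canonicalPartition (Torus.geometry (Fin 3)) (hsDiameter σ N) (N + 1) (localGibbsProfile a₁ u₁ θ₁))⁻¹ *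
        tensorPow (N + 1) (localGibbsProfile a₁ u₁ θ₁) z) := by
    rw [← localGibbsLaw_eq_particleLaw_tensorPow Φ]
    exact isProbabilityMeasure_localGibbsLaw ha₁ hθ₁ hu₁ ha₁0 hθ₁0 hσ2' N Φ
  haveI hΨ₂ : IsProbabilityMeasure (particleLaw Φ fun z =>
      (canonicalPartition (Torus.geometry (Fin 3)) (hsDiameter σ N) (N + 1) (localGibbsProfile a₂ u₂ θ₂))⁻¹ *
        tensorPow (N + 1) (localGibbsProfile a₂ u₂ θ₂) z) := by
    rw [← localGibbsLaw_eq_particleLaw_tensorPow Φ]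
    exact isProbabilityMeasure_localGibbsLaw ha₂ hθ₂ hu₂ ha₂0 hθ₂0 hσ2' N Φ
  rw [localGibbsLaw_eq_particleLaw_tensorPow Φ] at hkl ⊢
  rw [localGibbsLaw_eq_particleLaw_tensorPow Φ]
  -- integrability of the log-densities from the kinetic energy
  -- abbreviations: the two log-profile pairings and the two log-partition functions
  set L₁ : Config (N + 1) (Fin 3) T3 → ℝ := fun z =>
    ∫ y, Real.log (localGibbsProfile a₁ u₁ θ₁ y) ∂(empiricalMeasure z) with hL₁
  set L₂ : Config (N + 1) (Fin 3) T3 → ℝ := fun z =>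
    ∫ y, Real.log (localGibbsProfile a₂ u₂ θ₂ y) ∂(empiricalMeasure z) with hL₂
  set lZ₁ : ℝ := Real.log
    (canonicalPartition (Torus.geometry (Fin 3)) (hsDiameter σ N) (N + 1) (localGibbsProfile a₁ u₁ θ₁)) with hlZ₁
  set lZ₂ : ℝ := Real.log
    (canonicalPartition (Torus.geometry (Fin 3)) (hsDiameter σ N) (N + 1) (localGibbsProfile a₂ u₂ θ₂)) with hlZ₂
  have hI₁ : Integrable (fun z => L₁ z) (particleLaw Φ W₀) :=
    integrable_logPair_comp ha₁ hθ₁ hu₁ ha₁0 hθ₁0 measurable_id hK0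
  have hI₂ : Integrable (fun z => L₂ (Φ.flow t z)) (particleLaw Φ W₀) :=
    integrable_logPair_comp ha₂ hθ₂ hu₂ ha₂0 hθ₂0 (Φ.measurable_flow t) hKt
  have hA₁ : Integrable (fun z => ((N : ℝ) + 1) * L₁ z) (particleLaw Φ W₀) := hI₁.const_mul _
  have hA₂ : Integrable (fun z => ((N : ℝ) + 1) * L₂ (Φ.flow t z)) (particleLaw Φ W₀) :=
    hI₂.const_mul _
  have hlog₁ : ∀ z, Real.log ((canonicalPartition (Torus.geometry (Fin 3)) (hsDiameter σ N) (N + 1) (localGibbsProfile a₁ u₁ θ₁))⁻¹ *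
      tensorPow (N + 1) (localGibbsProfile a₁ u₁ θ₁) z) = ((N : ℝ) + 1) * L₁ z - lZ₁ :=
    log_gibbsDensity hσ2' N ha₁ hθ₁ hu₁ ha₁0 hθ₁0
  have hlog₂ : ∀ z, Real.log ((canonicalPartition (Torus.geometry (Fin 3)) (hsDiameter σ N) (N + 1) (localGibbsProfile a₂ u₂ θ₂))⁻¹ *
      tensorPow (N + 1) (localGibbsProfile a₂ u₂ θ₂) z) = ((N : ℝ) + 1) * L₂ z - lZ₂ :=
    log_gibbsDensity hσ2' N ha₂ hθ₂ hu₂ ha₂0 hθ₂0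
  have hint₁ : Integrable (fun z => Real.log ((canonicalPartition (Torus.geometry (Fin 3)) (hsDiameter σ N) (N + 1) (localGibbsProfile a₁ u₁ θ₁))⁻¹ *
      tensorPow (N + 1) (localGibbsProfile a₁ u₁ θ₁) z)) (particleLaw Φ W₀) := by
    simp_rw [hlog₁]
    exact hA₁.sub (integrable_const _)
  have hint₂ : Integrable (fun z => Real.log ((canonicalPartition (Torus.geometry (Fin 3)) (hsDiameter σ N) (N + 1) (localGibbsProfile a₂ u₂ θ₂))⁻¹ *
      tensorPow (N + 1) (localGibbsProfile a₂ u₂ θ₂) (Φ.flow t z))) (particleLaw Φ W₀) := by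
    simp_rw [hlog₂]
    exact hA₂.sub (integrable_const _)
  rw [toReal_klDiv_lawAt_particleLaw Φ hW (measurable_gibbsDensity σ N ha₁ hθ₁ hu₁)
    (measurable_gibbsDensity σ N ha₂ hθ₂ hu₂) hW0 (gibbsDensity_pos hσ2' N ha₁ hθ₁ hu₁ ha₁0 hθ₁0)
    (gibbsDensity_pos hσ2' N ha₂ hθ₂ hu₂ ha₂0 hθ₂0) hkl t hint₁ hint₂]
  simp_rw [hlog₁, hlog₂]
  have hA : Integrable (fun z => ((N : ℝ) + 1) * L₁ z - ((N : ℝ) + 1) * L₂ (Φ.flow t z))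
      (particleLaw Φ W₀) := hA₁.sub hA₂
  have hB : Integrable (fun _ : Config (N + 1) (Fin 3) T3 => lZ₂ - lZ₁) (particleLaw Φ W₀) :=
    integrable_const _
  rw [show (fun z => ((N : ℝ) + 1) * L₁ z - lZ₁ - (((N : ℝ) + 1) * L₂ (Φ.flow t z) - lZ₂)) =
      fun z => ((N : ℝ) + 1) * L₁ z - ((N : ℝ) + 1) * L₂ (Φ.flow t z) + (lZ₂ - lZ₁) from
      funext fun z => by ring,
    integral_add hA hB, integral_sub hA₁ hA₂, integral_const_mul, integral_const_mul,
    integral_const, smul_eq_mul, probReal_univ, one_mul]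
  ring

end StubLedger

/-- Registered sub-goal `stub_ledger_transport` of the stub `stub_ledger`: conjunct (L1), the
two-reference Liouville transport identity for local Gibbs references
(`StubLedger.ledger_transport`). [folklore] -/
theorem stub_ledger_transport : ∀ σ : ℝ, 0 < σ → σ < 2⁻¹ → ∀ (N : ℕ) (Φ : HardSphereFlow (Torus.geometry (Fin 3)) (hsDiameter σ N) (N + 1)) (a₁ θ₁ a₂ θ₂ : T3 → ℝ) (u₁ u₂ : T3 → V3), Continuous a₁ → Continuous θ₁ → Continuous u₁ → Continuous a₂ → Continuous θ₂ → Continuous u₂ → (∀ x, 0 < a₁ x) → (∀ x, 0 < θ₁ x) → (∀ x, 0 < a₂ x) → (∀ x, 0 < θ₂ x) → ∀ (W₀ : Config (N + 1) (Fin 3) T3 → ℝ), Measurable W₀ → (∀ z, 0 ≤ W₀ z) → IsProbabilityMeasure (particleLaw Φ W₀) → klDiv (particleLaw Φ W₀) (localGibbsLaw σ a₁ u₁ θ₁ N Φ) ≠ ⊤ → ∀ t : ℝ, Integrable (fun z => ∫ y, ‖y.2‖ ^ 2 ∂(empiricalMeasure z)) (particleLaw Φ W₀) → Integrable (fun z =>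 ∫ y, ‖y.2‖ ^ 2 ∂(empiricalMeasure (Φ.flow t z))) (particleLaw Φ W₀) → (klDiv (Φ.lawAt (particleLaw Φ W₀) t) (localGibbsLaw σ a₂ u₂ θ₂ N Φ)).toReal = (klDiv (particleLaw Φ W₀) (localGibbsLaw σ a₁ u₁ θ₁ N Φ)).toReal + ((N : ℝ) + 1) * ((∫ z, (∫ y, Real.log (localGibbsProfile a₁ u₁ θ₁ y) ∂(empiricalMeasure z)) ∂(particleLaw Φ W₀)) - ∫ z, (∫ y, Real.log (localGibbsProfile a₂ u₂ θ₂ y) ∂(empiricalMeasure (Φ.flow t z))) ∂(particleLaw Φ W₀)) + Real.log (canonicalPartition (Torus.geometry (Fin 3)) (hsDiameter σ N) (N + 1) (localGibbsProfile a₂ u₂ θ₂)) - Real.log (canonicalPartition (Torus.geometry (Fin 3)) (hsDiameter σ N) (N + 1) (localGibbsProfile a₁ u₁ θ₁)) :=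
  fun _ _ hσ2 N Φ a₁ θ₁ a₂ θ₂ u₁ u₂ ha₁ hθ₁ hu₁ ha₂ hθ₂ hu₂ ha₁0 hθ₁0 ha₂0 hθ₂0 W₀ hW hW0 hP hkl t
      hK0 hKt =>
    StubLedger.ledger_transport hσ2 N Φ a₁ θ₁ a₂ θ₂ u₁ u₂ ha₁ hθ₁ hu₁ ha₂ hθ₂ hu₂ ha₁0 hθ₁0 ha₂0 hθ₂0
      W₀ hW hW0 hP hkl t hK0 hKt

end Summit.AtomisticToContinuum.HydrodynamicLimit.Theorems.MacroClosureLine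

end
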